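import Literature.MathematicalPhysics.QuantumFieldTheory.Balaban1983to89.B8LeafModelZd3
import Literature.MathematicalPhysics.QuantumFieldTheory.Balaban1983to89.B8LeafModelZd3Map
import Literature.MathematicalPhysics.QuantumFieldTheory.Balaban1983to89.T4TermwiseTorus
import Literature.MathematicalPhysics.QuantumFieldTheory.Balaban1983to89.B12Ineq417Flat

/-!
# `Balaban1983to89.B8LeafModelZdPer` — [Balaban1985RegularSpaces] THE `P`-PERIODIC SUB-MODEL OF THE GENERAL-BACKGROUND `ℤᵈ × 𝔸`
# FAMILY `B8LeafModelZd3.zdGF3` AS A FULL LEAF CARRIER `B8SectGH.GFData3` — print's FINITE torus `T_η` (p. 77 «Ω₀ = T_η») read as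
# `P`-periodic data on the universal cover `ℤᵈ`

statement-level skeleton of published theorems with citation tags; proofs where landed; nothing here is a claim about the
Yang–Mills mass gap

PDF held: `paper:balaban1985-cmp99-regular-spaces-gauge-fixing` (journal page = PDF page + 74); pp. 77, 82–83, 86–88, 100–101.

## THE PRINTED TEXT

p. 77 [PDF 3]: «Let us consider a sequence of domains Ω₀ ⊃ Ω₁ ⊃ … ⊃ Ω_k … we admit the case when some domains Ω_j are equal to T_η» —
`T_η` is the FINITE torus of [Balaban1985Averaging] (4) p. 18; every configuration, gauge transformation and source of Theorems 2 ∕ 4 ∕ 8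
and Propositions 3 ∕ 7 lives on it.  A field on the torus of period `P` (in units of `η`) in every coordinate direction IS a `P`-periodic
field on `ℤᵈ` (`T4TermwiseTorus.IsPeriodic.descends`: «a periodic field is the pull-back of a unique field on the torus»).

## WHY THIS FILE (cell `pub-ymgap`, HUMAN RULING D-0062; director-ym №217 (1) «WORD = (Q2): (β′-PERIODIC) is the road of record behind the
[B8] display»; plan g86 PENS-217 (P1) «MEMBER MODEL `B8LeafModelZdPer` — pen = dag-n05-c: the `P`-periodic sub-model of n05-a's `zdGF3` as a
`B8SectGH.GFData3` — periodic `Cfg ∕ Pert ∕ Src` subtypes, bodies := `zdGF3`'s on `.1`, `Ω 0 = univ` KEPT»; count-neutral)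

The N05 family of record `Node00.CarriersB8.famB8OfRecord θ β len i := zdGF3 θ.𝔸 θ.L β len i.1` ranges over `IdxB8 θ := {i : ZdIdx ∕∕ i.Ω 0 = univ}` —
the INFINITE lattice `ℤᵈ` as top domain (forced: Theorem 2's typed sentence is boundary-refuted at every member with `Ω₀ ⊊ ℤᵈ`,
`B8LeafModelZd3Boundary.not_thm2Printed_zdGF3`).  The in-edge [Balaban1985BackgroundPropagators] (NODE N06) supplies its OBJECTS — `G(U₀)`,
`R(U₀)`, the Landau projections — by FINITE-dimensional linear algebra (`B9Eq327GreenZd.gopZd`, `B9Eq321LandauProjectionZd.projE`: `(Ω₀).Finite`),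
so the J-N06→N05 junction cannot close at `Ω₀ = ℤᵈ` members as typed (dag-n05-d g13∕g14 JUNCTION ROAD NOTEs).  Print's own carrier is
finite AND boundaryless: the torus.  THIS FILE is the [B8]-side member model of the periodic road: the member `zdGF3Per 𝔸 L β len i P` has
EXACTLY `zdGF3`'s bodies, read on `P`-periodic unitary configurations, `P`-periodic gauge transformations and `P`-periodic sources — the
finite-dimensional data N06's objects act on — and NOTHING else changes (`Ω 0 = univ`, the geometry `i : ZdIdx`, every predicate).
Periodicity of the GEOMETRY (`Ω_j`, `Λ_j`, `𝔅`) is the index LAW of the Node-00 pin (plan (P2), `Node00/CarriersB8Per`), not a model field.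
The periodicity predicate is the tree's generic `T4TermwiseTorus.IsPeriodic P F := ∀ x m, F (x + (P:ℤ) • m) = F x` (REUSED); §4's
`isPeriodic_iff_shiftCfg` is its bridge to the per-direction form `∀ μ, shiftCfg ((P:ℤ) • e_μ) F = F` of lit-balaban's
`B8Thm2TorusAt.Thm2TorusAt` ∕ `B8Thm2TorusLettersPer.LettersAtPer` (sub-row G-B8-T2S, the periodic road already walked for Theorem 2 at
`Ω_j = T_η`).

## WHAT IS PROVED (kernel, 0 sorry)

§1 the member `zdGF3Per`; §2 the projections `cfgZd ∕ pertZd ∕ gtZd ∕ srcZd` onto `zdGF3`'s carriers; §3 FIELD TRANSFER: every predicate ∕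
norm of `zdGF3Per` IS `zdGF3`'s at the projected arguments (`Iff.rfl` ∕ `rfl`), and `pertZd (act P u) = zdGF3.act (pertZd P) (gtZd u)`;
§4 CLOSURE ∕ NON-VACUITY: `isPeriodic_iff_shiftCfg`, constants ∕ products ∕ inverses ∕ the moving-frame gauge action (55) of periodic data
are periodic (`isPeriodic_mgauge`), the four carriers are inhabited; §5 THE FREE ∀-TRANSFER: Proposition 3 (a pure-∀ conjunct of the
leaf) passes from the `zdGF3` family to the periodic family along ANY index ∕ period maps (`prop3Body_per_of_zd`, `prop3Printed_per_of_zd`),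
hence n05-a's `prop3Printed_zd3` gives **`prop3Printed_zdPer`** (modulo the same per-member socket `SockB9P3`); v1.1 (dag-n05-w2 P5 NIT-1):
**`prop3Printed_zdPer_map`** — the same with the socket asked AT THE IMAGE MEMBERS `ι j` ONLY (n05-a's `B8LeafModelZd3Map.prop3Printed_zd3_map`), the
junction-ready form on the periodic road (N06's objects feed the socket at periodic members only).

## HONEST SCOPE

(i) A DEFINITION file with bookkeeping lemmas: nothing of [Balaban1985RegularSpaces]'s estimates is proved here.  (ii) The ∃!-conjuncts
(Theorems 2 ∕ 4 ∕ 8: «exactly one gauge transformation u») are NOT transferred in this file: at a member whose geometry is `P`-periodic the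
unique `u` of the full model is periodic by translation covariance of `Restricted ∕ C136 ∕ C137 ∕ Landau ∕ C139 ∕ C162 ∕ act` — the
closed-invariant-set device of `B8SectEKLevelPer` — which needs the index law of (P2); v1.1.  (iii) `Reg335 := True` exactly as in `zdGF3`
((3.35) of [4] dropped by print via Prop. 6).  (iv) `P = 0` is allowed by the types (then `IsPeriodic 0` is no condition and `zdGF3Per … 0`
is `zdGF3` up to the subtype wrappers); the pin takes `P ≥ 1` with `Lᵏ ∣ P`.  Count-neutral; N05 NOT discharged; one finite `T⁴` programme at
fixed `ε`; nothing continuum ∕ ℝ⁴ ∕ OS ∕ mass-gap ∕ Clay.  Unit `pub-ymgap-dag-n05-c` (g16), 2026-08-28.  No `sorry`, no `axiom`, no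
`instance`, no `notation`.
-/

noncomputable section

open NormedSpace

namespace Literature.MathematicalPhysics.QuantumFieldTheory.Balaban1983to89.B8LeafModelZdPer

open B7Prop1Explicit B7Prop2Explicit B7Eq92Concrete
open B8Lemma1NonAbelian (mulCfg)
open B8LeafModelZd (ZdIdx)
open B8LeafModelZd3 (zdGF3 SockB9P3)
open B8Prop3GaugeFixedKLevel (mem_unitaryUnits_of_mgauge_eq)
open B8Thm4AtLandau138 (mgauge_mgauge_inv)
open T4TermwiseTorus (IsPeriodic)
open B12Ineq417Flat (shiftCfg shiftCfg_apply)

-- `Site` alone could resolve to the torus sites of `Setup.lean`; re-export the `ℤ^d` sites of `B7Prop1Explicit`.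
export B7Prop1Explicit (Site)

variable {d : ℕ}

/-! ## §1 The member: `zdGF3` read on `P`-periodic data -/

section Family

variable (𝔸 : Type) [CStarAlgebra 𝔸] (L : ℕ) (β : ℝ) (len : Site d → ℝ)

/-- **The `P`-periodic sub-model of the general-background `ℤᵈ × 𝔸` member** `B8LeafModelZd3.zdGF3 𝔸 L β len i` as the full leaf carrier
`B8SectGH.GFData3`: configurations, perturbation pairs, gauge transformations and sources are those of `zdGF3` that are `P`-PERIODIC
(`T4TermwiseTorus.IsPeriodic P`: «a field on the torus `(ℤ∕Pℤ)ᵈ` read on the universal cover»), and EVERY predicate ∕ norm is `zdGF3`'s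
body evaluated at the underlying `ℤᵈ` fields (print's Theorems 2 ∕ 4 ∕ 8 and Propositions 3 ∕ 7 live on the finite torus `T_η`, p. 77; the
geometry `i` — `η, k, {Ω_j}, Λ_j, 𝔅` with `Ω₀ = T_η ↦ ℤᵈ` — is n05-a's `ZdIdx` verbatim).
[cite: Balaban1985RegularSpaces, p.77 («Ω₀ ⊃ Ω₁ ⊃ … ⊃ Ω_k … we admit the case when some domains Ω_j are equal to T_η»), (1.29) p.81, (1.33)–(1.39) pp.82–83, (1.40) p.83, (1.62) p.87, (1.66) p.88, (1.140) p.100, (1.146) p.101; Balaban1985Averaging, (4) p.18] -/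
def zdGF3Per (i : ZdIdx d L) (P : ℕ) : B8SectGH.GFData3 where
  Cfg := {U : Site d → Fin d → 𝔸ˣ // (∀ x κ, U x κ ∈ unitaryUnits 𝔸) ∧ IsPeriodic P U}
  Pert := {U : Site d → Fin d → 𝔸ˣ // (∀ x κ, U x κ ∈ unitaryUnits 𝔸) ∧ IsPeriodic P U} ×
    {U : Site d → Fin d → 𝔸ˣ // (∀ x κ, U x κ ∈ unitaryUnits 𝔸) ∧ IsPeriodic P U}
  GT := {u : Site d → 𝔸ˣ // ((∀ x, u x ∈ unitaryUnits 𝔸) ∧ ∀ x, x ∉ i.Ω 0 → u x = 1) ∧ IsPeriodic P u}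
  Src := {f : Site d → 𝔸 // IsPeriodic P f}
  k := i.k
  InA := fun α U₀ => (zdGF3 𝔸 L β len i).InA α ⟨U₀.1, U₀.2.1⟩
  Reg335 := fun α U₀ => (zdGF3 𝔸 L β len i).Reg335 α ⟨U₀.1, U₀.2.1⟩
  InAAx := fun α U₀ Q => (zdGF3 𝔸 L β len i).InAAx α ⟨U₀.1, U₀.2.1⟩ (⟨Q.1.1, Q.1.2.1⟩, ⟨Q.2.1, Q.2.2.1⟩)
  avgClose := fun α U₀ Q => (zdGF3 𝔸 L β len i).avgClose α ⟨U₀.1, U₀.2.1⟩ (⟨Q.1.1, Q.1.2.1⟩, ⟨Q.2.1, Q.2.2.1⟩)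
  avgClose166 := fun α U₀ Q => (zdGF3 𝔸 L β len i).avgClose166 α ⟨U₀.1, U₀.2.1⟩ (⟨Q.1.1, Q.1.2.1⟩, ⟨Q.2.1, Q.2.2.1⟩)
  Restricted := fun U₀ u => (zdGF3 𝔸 L β len i).Restricted ⟨U₀.1, U₀.2.1⟩ ⟨u.1, u.2.1⟩
  act := fun Q u => (Q.1, ⟨mgauge Q.1.1 u.1⁻¹ Q.2.1,
    fun x κ => mem_unitaryUnits_of_mgauge_eq Q.1.2.1 Q.2.2.1 u.2.1.1 (mgauge_mgauge_inv Q.1.1 Q.2.1 u.1) x κ,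
    fun x m => funext fun κ => by
      have h1 : u.1⁻¹ (x + (P : ℤ) • m) = u.1⁻¹ x := by simp only [Pi.inv_apply, u.2.2 x m]
      have h2 : u.1⁻¹ (x + (P : ℤ) • m + e κ) = u.1⁻¹ (x + e κ) := by
        simp only [Pi.inv_apply, add_right_comm x ((P : ℤ) • m) (e κ), u.2.2 (x + e κ) m]
      simp only [mgauge_apply, h1, h2, congrFun (Q.1.2.2 x m) κ, congrFun (Q.2.2.2 x m) κ]⟩)
  C136 := fun B₁ B₂ s U₀ Q => (zdGF3 𝔸 L β len i).C136 B₁ B₂ s ⟨U₀.1, U₀.2.1⟩ (⟨Q.1.1, Q.1.2.1⟩, ⟨Q.2.1, Q.2.2.1⟩)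
  C137 := fun α₁ U₀ Q => (zdGF3 𝔸 L β len i).C137 α₁ ⟨U₀.1, U₀.2.1⟩ (⟨Q.1.1, Q.1.2.1⟩, ⟨Q.2.1, Q.2.2.1⟩)
  Landau := fun U₀ Q => (zdGF3 𝔸 L β len i).Landau ⟨U₀.1, U₀.2.1⟩ (⟨Q.1.1, Q.1.2.1⟩, ⟨Q.2.1, Q.2.2.1⟩)
  C139 := fun B s U₀ Q => (zdGF3 𝔸 L β len i).C139 B s ⟨U₀.1, U₀.2.1⟩ (⟨Q.1.1, Q.1.2.1⟩, ⟨Q.2.1, Q.2.2.1⟩)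
  C162 := fun B s U₀ Q => (zdGF3 𝔸 L β len i).C162 B s ⟨U₀.1, U₀.2.1⟩ (⟨Q.1.1, Q.1.2.1⟩, ⟨Q.2.1, Q.2.2.1⟩)
  fNorm := fun f => (zdGF3 𝔸 L β len i).fNorm f.1
  LandauF := fun U₀ f Q => (zdGF3 𝔸 L β len i).LandauF ⟨U₀.1, U₀.2.1⟩ f.1 (⟨Q.1.1, Q.1.2.1⟩, ⟨Q.2.1, Q.2.2.1⟩)
  InAPair := fun α U₀ Q => (zdGF3 𝔸 L β len i).InAPair α ⟨U₀.1, U₀.2.1⟩ (⟨Q.1.1, Q.1.2.1⟩, ⟨Q.2.1, Q.2.2.1⟩)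
  fGrad := fun U₀ f => (zdGF3 𝔸 L β len i).fGrad ⟨U₀.1, U₀.2.1⟩ f.1
  C140 := fun α₂ U₀ Q => (zdGF3 𝔸 L β len i).C140 α₂ ⟨U₀.1, U₀.2.1⟩ (⟨Q.1.1, Q.1.2.1⟩, ⟨Q.2.1, Q.2.2.1⟩)
  InR := fun U₀ f => (zdGF3 𝔸 L β len i).InR ⟨U₀.1, U₀.2.1⟩ f.1

end Family

/-! ## §2 The projections onto `zdGF3`'s carriers -/

section Projections

variable {𝔸 : Type} [CStarAlgebra 𝔸] {L : ℕ} {β : ℝ} {len : Site d → ℝ} {i : ZdIdx d L} {P : ℕ}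

/-- The underlying configuration of `zdGF3` (forget periodicity). [cite: Balaban1985RegularSpaces, p.77 («Ω₀ = T_η»)] -/
def cfgZd (U : (zdGF3Per 𝔸 L β len i P).Cfg) : (zdGF3 𝔸 L β len i).Cfg := ⟨U.1, U.2.1⟩

/-- The underlying perturbation pair of `zdGF3` (forget periodicity). [cite: Balaban1985RegularSpaces, p.77 («Ω₀ = T_η»), (1.34) p.82] -/
def pertZd (Q : (zdGF3Per 𝔸 L β len i P).Pert) : (zdGF3 𝔸 L β len i).Pert := (⟨Q.1.1, Q.1.2.1⟩, ⟨Q.2.1, Q.2.2.1⟩)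

/-- The underlying gauge transformation of `zdGF3` (forget periodicity). [cite: Balaban1985RegularSpaces, p.77 («Ω₀ = T_η»), (1.29) p.81] -/
def gtZd (u : (zdGF3Per 𝔸 L β len i P).GT) : (zdGF3 𝔸 L β len i).GT := ⟨u.1, u.2.1⟩

/-- The underlying source of `zdGF3` (forget periodicity). [cite: Balaban1985RegularSpaces, p.77 («Ω₀ = T_η»), (1.146) p.101] -/
def srcZd (f : (zdGF3Per 𝔸 L β len i P).Src) : (zdGF3 𝔸 L β len i).Src := f.1

/-- [cite: Balaban1985RegularSpaces, p.77 (bookkeeping)] -/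
@[simp] theorem cfgZd_val (U : (zdGF3Per 𝔸 L β len i P).Cfg) : (cfgZd U).1 = U.1 := rfl

/-- [cite: Balaban1985RegularSpaces, p.77 (bookkeeping)] -/
@[simp] theorem pertZd_fst_val (Q : (zdGF3Per 𝔸 L β len i P).Pert) : (pertZd Q).1.1 = Q.1.1 := rfl

/-- [cite: Balaban1985RegularSpaces, p.77 (bookkeeping)] -/
@[simp] theorem pertZd_snd_val (Q : (zdGF3Per 𝔸 L β len i P).Pert) : (pertZd Q).2.1 = Q.2.1 := rfl

/-- [cite: Balaban1985RegularSpaces, p.77 (bookkeeping)] -/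
@[simp] theorem gtZd_val (u : (zdGF3Per 𝔸 L β len i P).GT) : (gtZd u).1 = u.1 := rfl

/-- [cite: Balaban1985RegularSpaces, p.77 (bookkeeping)] -/
@[simp] theorem srcZd_eq (f : (zdGF3Per 𝔸 L β len i P).Src) : srcZd f = f.1 := rfl

/-- The carriers remember periodicity. [cite: Balaban1985RegularSpaces, p.77 («Ω₀ = T_η»)] -/
theorem cfg_isPeriodic (U : (zdGF3Per 𝔸 L β len i P).Cfg) : IsPeriodic P U.1 := U.2.2

/-- [cite: Balaban1985RegularSpaces, p.77 («Ω₀ = T_η»)] -/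
theorem pert_isPeriodic (Q : (zdGF3Per 𝔸 L β len i P).Pert) : IsPeriodic P Q.1.1 ∧ IsPeriodic P Q.2.1 := ⟨Q.1.2.2, Q.2.2.2⟩

/-- [cite: Balaban1985RegularSpaces, p.77 («Ω₀ = T_η»)] -/
theorem gt_isPeriodic (u : (zdGF3Per 𝔸 L β len i P).GT) : IsPeriodic P u.1 := u.2.2

/-- [cite: Balaban1985RegularSpaces, p.77 («Ω₀ = T_η»)] -/
theorem src_isPeriodic (f : (zdGF3Per 𝔸 L β len i P).Src) : IsPeriodic P f.1 := f.2

/-- The number of levels is the geometry's `k`. [cite: Balaban1985RegularSpaces, (1.3) p.77] -/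
theorem k_eq : (zdGF3Per 𝔸 L β len i P).k = i.k := rfl

end Projections

/-! ## §3 Field transfer: every predicate ∕ norm of `zdGF3Per` IS `zdGF3`'s at the projected arguments -/

section Transfer

variable {𝔸 : Type} [CStarAlgebra 𝔸] {L : ℕ} {β : ℝ} {len : Site d → ℝ} {i : ZdIdx d L} {P : ℕ}

/-- (1.33) `U₀ ∈ 𝔄_k`. [cite: Balaban1985RegularSpaces, (1.33) p.82] -/
theorem inA_iff (α : ℝ) (U₀ : (zdGF3Per 𝔸 L β len i P).Cfg) :
    (zdGF3Per 𝔸 L β len i P).InA α U₀ ↔ (zdGF3 𝔸 L β len i).InA α (cfgZd U₀) := Iff.rfl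

/-- «(3.35) of [4]» (dropped by print: `True`). [cite: Balaban1985RegularSpaces, p.83 («eventually we will drop it»)] -/
theorem reg335_iff (α : ℝ) (U₀ : (zdGF3Per 𝔸 L β len i P).Cfg) :
    (zdGF3Per 𝔸 L β len i P).Reg335 α U₀ ↔ (zdGF3 𝔸 L β len i).Reg335 α (cfgZd U₀) := Iff.rfl

/-- (1.34) `U′U₀ ∈ 𝔄_k ∩ Ax_k(𝔅_k, U₀)`. [cite: Balaban1985RegularSpaces, (1.34) p.82] -/
theorem inAAx_iff (α : ℝ) (U₀ : (zdGF3Per 𝔸 L β len i P).Cfg) (Q : (zdGF3Per 𝔸 L β len i P).Pert) :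
    (zdGF3Per 𝔸 L β len i P).InAAx α U₀ Q ↔ (zdGF3 𝔸 L β len i).InAAx α (cfgZd U₀) (pertZd Q) := Iff.rfl

/-- (1.35). [cite: Balaban1985RegularSpaces, (1.35) p.82] -/
theorem avgClose_iff (α : ℝ) (U₀ : (zdGF3Per 𝔸 L β len i P).Cfg) (Q : (zdGF3Per 𝔸 L β len i P).Pert) :
    (zdGF3Per 𝔸 L β len i P).avgClose α U₀ Q ↔ (zdGF3 𝔸 L β len i).avgClose α (cfgZd U₀) (pertZd Q) := Iff.rfl

/-- (1.66). [cite: Balaban1985RegularSpaces, (1.66) p.88] -/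
theorem avgClose166_iff (α : ℝ) (U₀ : (zdGF3Per 𝔸 L β len i P).Cfg) (Q : (zdGF3Per 𝔸 L β len i P).Pert) :
    (zdGF3Per 𝔸 L β len i P).avgClose166 α U₀ Q ↔ (zdGF3 𝔸 L β len i).avgClose166 α (cfgZd U₀) (pertZd Q) := Iff.rfl

/-- (1.29) `(R̄₀uʲ)(y) = 1` on `Λ_j`. [cite: Balaban1985RegularSpaces, (1.29) p.81] -/
theorem restricted_iff (U₀ : (zdGF3Per 𝔸 L β len i P).Cfg) (u : (zdGF3Per 𝔸 L β len i P).GT) :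
    (zdGF3Per 𝔸 L β len i P).Restricted U₀ u ↔ (zdGF3 𝔸 L β len i).Restricted (cfgZd U₀) (gtZd u) := Iff.rfl

/-- The gauge action commutes with forgetting periodicity: `U′^{u⁻¹}` relative to `U₀` ((55) of [3]). [cite: Balaban1985Averaging, (55) p.27; Balaban1985RegularSpaces, p.83] -/
theorem pertZd_act (Q : (zdGF3Per 𝔸 L β len i P).Pert) (u : (zdGF3Per 𝔸 L β len i P).GT) :
    pertZd ((zdGF3Per 𝔸 L β len i P).act Q u) = (zdGF3 𝔸 L β len i).act (pertZd Q) (gtZd u) := rfl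

/-- (1.36). [cite: Balaban1985RegularSpaces, (1.36) p.82] -/
theorem c136_iff (B₁ B₂ s : ℝ) (U₀ : (zdGF3Per 𝔸 L β len i P).Cfg) (Q : (zdGF3Per 𝔸 L β len i P).Pert) :
    (zdGF3Per 𝔸 L β len i P).C136 B₁ B₂ s U₀ Q ↔ (zdGF3 𝔸 L β len i).C136 B₁ B₂ s (cfgZd U₀) (pertZd Q) := Iff.rfl

/-- (1.37). [cite: Balaban1985RegularSpaces, (1.37) p.82] -/
theorem c137_iff (α₁ : ℝ) (U₀ : (zdGF3Per 𝔸 L β len i P).Cfg) (Q : (zdGF3Per 𝔸 L β len i P).Pert) :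
    (zdGF3Per 𝔸 L β len i P).C137 α₁ U₀ Q ↔ (zdGF3 𝔸 L β len i).C137 α₁ (cfgZd U₀) (pertZd Q) := Iff.rfl

/-- (1.38) the Landau gauge of record. [cite: Balaban1985RegularSpaces, (1.38) p.82] -/
theorem landau_iff (U₀ : (zdGF3Per 𝔸 L β len i P).Cfg) (Q : (zdGF3Per 𝔸 L β len i P).Pert) :
    (zdGF3Per 𝔸 L β len i P).Landau U₀ Q ↔ (zdGF3 𝔸 L β len i).Landau (cfgZd U₀) (pertZd Q) := Iff.rfl

/-- (1.39). [cite: Balaban1985RegularSpaces, (1.39) p.83] -/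
theorem c139_iff (B s : ℝ) (U₀ : (zdGF3Per 𝔸 L β len i P).Cfg) (Q : (zdGF3Per 𝔸 L β len i P).Pert) :
    (zdGF3Per 𝔸 L β len i P).C139 B s U₀ Q ↔ (zdGF3 𝔸 L β len i).C139 B s (cfgZd U₀) (pertZd Q) := Iff.rfl

/-- (1.62) ∕ (1.140)₁. [cite: Balaban1985RegularSpaces, (1.62) p.87] -/
theorem c162_iff (B s : ℝ) (U₀ : (zdGF3Per 𝔸 L β len i P).Cfg) (Q : (zdGF3Per 𝔸 L β len i P).Pert) :
    (zdGF3Per 𝔸 L β len i P).C162 B s U₀ Q ↔ (zdGF3 𝔸 L β len i).C162 B s (cfgZd U₀) (pertZd Q) := Iff.rfl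

/-- `|f|₍₋₂₎`. [cite: Balaban1985RegularSpaces, Thm 8 p.101] -/
theorem fNorm_eq (f : (zdGF3Per 𝔸 L β len i P).Src) :
    (zdGF3Per 𝔸 L β len i P).fNorm f = (zdGF3 𝔸 L β len i).fNorm (srcZd f) := rfl

/-- (1.146). [cite: Balaban1985RegularSpaces, (1.146) p.101] -/
theorem landauF_iff (U₀ : (zdGF3Per 𝔸 L β len i P).Cfg) (f : (zdGF3Per 𝔸 L β len i P).Src) (Q : (zdGF3Per 𝔸 L β len i P).Pert) :
    (zdGF3Per 𝔸 L β len i P).LandauF U₀ f Q ↔ (zdGF3 𝔸 L β len i).LandauF (cfgZd U₀) (srcZd f) (pertZd Q) := Iff.rfl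

/-- (1.40)₂ `U₁U₀ ∈ 𝔄_k`. [cite: Balaban1985RegularSpaces, (1.40) p.83] -/
theorem inAPair_iff (α : ℝ) (U₀ : (zdGF3Per 𝔸 L β len i P).Cfg) (Q : (zdGF3Per 𝔸 L β len i P).Pert) :
    (zdGF3Per 𝔸 L β len i P).InAPair α U₀ Q ↔ (zdGF3 𝔸 L β len i).InAPair α (cfgZd U₀) (pertZd Q) := Iff.rfl

/-- `|D^η_{U₀} f|₍₋₃₎`. [cite: Balaban1985RegularSpaces, Thm 8 p.101] -/
theorem fGrad_eq (U₀ : (zdGF3Per 𝔸 L β len i P).Cfg) (f : (zdGF3Per 𝔸 L β len i P).Src) :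
    (zdGF3Per 𝔸 L β len i P).fGrad U₀ f = (zdGF3 𝔸 L β len i).fGrad (cfgZd U₀) (srcZd f) := rfl

/-- (1.140), three members. [cite: Balaban1985RegularSpaces, (1.140) p.100] -/
theorem c140_iff (α₂ : ℝ) (U₀ : (zdGF3Per 𝔸 L β len i P).Cfg) (Q : (zdGF3Per 𝔸 L β len i P).Pert) :
    (zdGF3Per 𝔸 L β len i P).C140 α₂ U₀ Q ↔ (zdGF3 𝔸 L β len i).C140 α₂ (cfgZd U₀) (pertZd Q) := Iff.rfl

/-- «f from the space R(U₀)». [cite: Balaban1985RegularSpaces, Thm 8 p.101, (1.38) p.82] -/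
theorem inR_iff (U₀ : (zdGF3Per 𝔸 L β len i P).Cfg) (f : (zdGF3Per 𝔸 L β len i P).Src) :
    (zdGF3Per 𝔸 L β len i P).InR U₀ f ↔ (zdGF3 𝔸 L β len i).InR (cfgZd U₀) (srcZd f) := Iff.rfl

end Transfer

/-! ## §4 Closure and non-vacuity of the periodic carriers -/

section Closure

variable {P : ℕ}

/-- **The lattice form and the per-direction form of periodicity agree**: `F (x + P·m) = F x` for every `m ∈ ℤᵈ` iff
`t_{P e_μ} F = F` for every coordinate direction `μ` — the binder form of lit-balaban's `B8Thm2TorusAt.Thm2TorusAt`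
(`shiftCfg (P • e μ) U₀ = U₀`) — a field on the torus `T_η` read on `ℤᵈ`. [cite: Balaban1985RegularSpaces, p.77 («Ω₀ = T_η»: fields on the finite torus); Balaban1985Averaging, (4) p.18] -/
theorem isPeriodic_iff_shiftCfg {β : Type*} (F : Site d → β) :
    IsPeriodic P F ↔ ∀ μ : Fin d, shiftCfg (((P : ℕ) : ℤ) • e μ) F = F := by
  constructor
  · intro h μ
    funext x
    rw [shiftCfg_apply]
    have := h x (e μ)
    simpa using this
  · intro h
    -- periodicity under every `P • m` from periodicity under the `d` generators `P • e_μ`, by induction on the support of `m`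
    have hdir : ∀ (μ : Fin d) (x : Site d) (t : ℤ), F (x + (t * (P : ℤ)) • e μ) = F x := by
      intro μ
      have hstep : ∀ x : Site d, F (x + ((P : ℤ)) • e μ) = F x := fun x => by
        have := congrFun (h μ) x
        rwa [shiftCfg_apply] at this
      have hnat : ∀ (n : ℕ) (x : Site d), F (x + ((n : ℤ) * (P : ℤ)) • e μ) = F x := by
        intro n
        induction n with
        | zero => intro x; simp
        | succ n ih =>
            intro x
            have e1 : x + (((n + 1 : ℕ) : ℤ) * (P : ℤ)) • e μ = (x + ((n : ℤ) * (P : ℤ)) • e μ) + (P : ℤ) • e μ := by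
              rw [add_assoc, ← add_smul]; congr 1; push_cast; ring_nf
            rw [e1, hstep, ih]
      intro x t
      obtain ⟨n, rfl | rfl⟩ := Int.eq_nat_or_neg t
      · exact hnat n x
      · have := hnat n (x + (-(n : ℤ) * (P : ℤ)) • e μ)
        rw [add_assoc, ← add_smul] at this
        simpa using this.symm
    intro x m
    -- write `P • m` as a sum over coordinates
    have hm : ((P : ℕ) : ℤ) • m = ∑ μ : Fin d, (m μ * (P : ℤ)) • e μ := by
      funext j
      simp only [Pi.smul_apply, smul_eq_mul, Finset.sum_apply, e, Pi.single_apply]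
      rw [Finset.sum_eq_single j]
      · simp [mul_comm]
      · intro b _ hb; simp [Ne.symm hb]
      · intro hj; exact absurd (Finset.mem_univ j) hj
    rw [hm]
    suffices hS : ∀ (s : Finset (Fin d)) (x : Site d), F (x + ∑ μ ∈ s, (m μ * (P : ℤ)) • e μ) = F x from hS _ x
    intro s
    induction s using Finset.induction_on with
    | empty => intro x; simp
    | insert μ s hμ ih =>
        intro x
        rw [Finset.sum_insert hμ, ← add_assoc, add_right_comm, hdir μ, ih]

/-- Constant fields are periodic (they descend to the torus `T_η`). [cite: Balaban1985RegularSpaces, p.77 («Ω₀ = T_η»)] -/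
theorem isPeriodic_const {β : Type*} (c : β) : IsPeriodic P (fun _ : Site d => c) := fun _ _ => rfl

variable {G : Type*} [Group G]

/-- Pointwise products of periodic bond configurations are periodic (`U = V′V₀`, (1.21)). [cite: Balaban1985RegularSpaces, (1.21) p.79] -/
theorem isPeriodic_mulCfg {V' V₀ : Site d → Fin d → G} (hV' : IsPeriodic P V') (hV₀ : IsPeriodic P V₀) :
    IsPeriodic P (mulCfg V' V₀) := fun x m => by
  funext μ
  simp only [mulCfg, congrFun (hV' x m) μ, congrFun (hV₀ x m) μ]

/-- Pointwise inverses of periodic gauge transformations are periodic (gauge transformations on the torus `T_η`). [cite: Balaban1985RegularSpaces, p.77 («Ω₀ = T_η»), (1.29) p.81] -/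
theorem isPeriodic_inv {u : Site d → G} (hu : IsPeriodic P u) : IsPeriodic P u⁻¹ := fun x m => by
  simp only [Pi.inv_apply, hu x m]

/-- **The moving-frame gauge action (55) of periodic data is periodic**: `V′^v_b = v(b₋)V′_b R(V_{0,b})v⁻¹(b₊)` with `V₀, V′, v`
all `P`-periodic. [cite: Balaban1985Averaging, (55) p.27] -/
theorem isPeriodic_mgauge {V₀ V₁ : Site d → Fin d → G} {v : Site d → G} (hV₀ : IsPeriodic P V₀) (hv : IsPeriodic P v)
    (hV₁ : IsPeriodic P V₁) : IsPeriodic P (mgauge V₀ v V₁) := fun x m => by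
  funext κ
  have h2 : v (x + (P : ℤ) • m + e κ) = v (x + e κ) := by rw [add_right_comm]; exact hv (x + e κ) m
  simp only [mgauge_apply, hv x m, h2, congrFun (hV₀ x m) κ, congrFun (hV₁ x m) κ]

variable {𝔸 : Type} [CStarAlgebra 𝔸] {L : ℕ} {β : ℝ} {len : Site d → ℝ} (i : ZdIdx d L) (P)

/-- The trivial background `U₀ ≡ 1` is a member configuration (unitary, periodic). [cite: Balaban1985RegularSpaces, (1.33) p.82] -/
theorem nonempty_cfg : Nonempty (zdGF3Per 𝔸 L β len i P).Cfg :=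
  ⟨⟨fun _ _ => 1, fun _ _ => (unitaryUnits 𝔸).one_mem, isPeriodic_const _⟩⟩

/-- [cite: Balaban1985RegularSpaces, (1.34) p.82] -/
theorem nonempty_pert : Nonempty (zdGF3Per 𝔸 L β len i P).Pert :=
  ⟨(⟨fun _ _ => 1, fun _ _ => (unitaryUnits 𝔸).one_mem, isPeriodic_const _⟩,
    ⟨fun _ _ => 1, fun _ _ => (unitaryUnits 𝔸).one_mem, isPeriodic_const _⟩)⟩

/-- The identity gauge transformation is a member (unitary, `= 1` off `Ω₀`, periodic). [cite: Balaban1985RegularSpaces, (1.29) p.81] -/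
theorem nonempty_gt : Nonempty (zdGF3Per 𝔸 L β len i P).GT :=
  ⟨⟨fun _ => 1, ⟨fun _ => (unitaryUnits 𝔸).one_mem, fun _ _ => rfl⟩, isPeriodic_const _⟩⟩

/-- The zero source is a member. [cite: Balaban1985RegularSpaces, Thm 8 p.101] -/
theorem nonempty_src : Nonempty (zdGF3Per 𝔸 L β len i P).Src :=
  ⟨⟨fun _ => 0, isPeriodic_const _⟩⟩

end Closure

/-! ## §5 The free ∀-transfer: Proposition 3 passes from the `zdGF3` family to the periodic family -/

section Prop3

variable {𝔸 : Type} [CStarAlgebra 𝔸] {L : ℕ} {β : ℝ} {len : Site d → ℝ}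

/-- **PROPOSITION 3's BODY TRANSFERS TO PERIODIC DATA** along any index map `ι` and period map `p`: Proposition 3 (p. 87) is a pure-∀
sentence over `(U₀, U₁)`, and the periodic member's hypotheses ∕ conclusions ARE the full member's at the underlying fields (§3).
[cite: Balaban1985RegularSpaces, Prop. 3 p.87] -/
theorem prop3Body_per_of_zd {J : Type} (ι : J → ZdIdx d L) (p : J → ℕ) {c : ℝ} {Lr C₂ : ℝ} {inp : B8.B9Inputs} {B₀β : ℝ}
    (h : B8.Prop3Body c d Lr C₂ inp B₀β (fun j : J => (zdGF3 𝔸 L β len (ι j)).toGFData2)) :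
    B8.Prop3Body c d Lr C₂ inp B₀β (fun j : J => (zdGF3Per 𝔸 L β len (ι j) (p j)).toGFData2) := by
  intro j α₀ α₁ α₂ hα₀ hα₀c hα₁ hα₁c hα₂ hα₂c hwin U₀ U₁ hInA hReg hPair h162 hLan h137
  exact h j α₀ α₁ α₂ hα₀ hα₀c hα₁ hα₁c hα₂ hα₂c hwin (cfgZd U₀) (pertZd U₁) hInA hReg hPair h162 hLan h137

/-- **PROPOSITION 3 TRANSFERS TO PERIODIC DATA** (same threshold). [cite: Balaban1985RegularSpaces, Prop. 3 p.87 («bounded by a constant depending on d and L only»)] -/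
theorem prop3Printed_per_of_zd {J : Type} (ι : J → ZdIdx d L) (p : J → ℕ) {Lr C₂ : ℝ} {inp : B8.B9Inputs} {B₀β : ℝ}
    (h : B8.Prop3Printed d Lr C₂ inp B₀β (fun j : J => (zdGF3 𝔸 L β len (ι j)).toGFData2)) :
    B8.Prop3Printed d Lr C₂ inp B₀β (fun j : J => (zdGF3Per 𝔸 L β len (ι j) (p j)).toGFData2) := by
  obtain ⟨c, hc, hb⟩ := h
  exact ⟨c, hc, prop3Body_per_of_zd ι p hb⟩

/-- **`B8.Prop3Printed` ON THE PERIODIC FAMILY** for every `C₂ ≥ 2097152(d+1)²`, `B₀β ≥ 0`, along any index ∕ period maps — n05-a's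
`B8LeafModelZd3.prop3Printed_zd3` (Proposition 3 at `k` levels, pp. 86–87, modulo the per-member [4]-Thm-3.3 socket `SockB9P3`) carried to
periodic data by `prop3Printed_per_of_zd`. [cite: Balaban1985RegularSpaces, Prop. 3 p.87, (1.36)–(1.40) pp.82–83, (1.59) p.86; Balaban1985BackgroundPropagators, Thm 3.3 p.399] -/
theorem prop3Printed_zdPer [Nontrivial 𝔸] (hd2 : 2 ≤ d) (hL : 2 ≤ L) (inp : B8.B9Inputs) {B₀β C₂ cP : ℝ} (hB₀β : 0 ≤ B₀β)
    (hC₂ : 2097152 * ((d : ℝ) + 1) ^ 2 ≤ C₂) (hcP : 0 < cP) (β : ℝ) (len : Site d → ℝ)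
    (SB9 : ∀ i : ZdIdx d L, SockB9P3 (𝔸 := 𝔸) L inp.B₀ B₀β cP β len i.η i.k i.Ω i.Λs i.Λb)
    {J : Type} (ι : J → ZdIdx d L) (p : J → ℕ) :
    B8.Prop3Printed d (L : ℝ) C₂ inp B₀β (fun j : J => (zdGF3Per 𝔸 L β len (ι j) (p j)).toGFData2) := by
  have h := B8LeafModelZd3.prop3Printed_zd3 (𝔸 := 𝔸) hd2 hL inp hB₀β hC₂ hcP β len SB9
  obtain ⟨c, hc, hb⟩ := h
  exact ⟨c, hc, prop3Body_per_of_zd ι p fun j => hb (ι j)⟩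

/-- ★ **`B8.Prop3Printed` ON THE PERIODIC FAMILY, SOCKET ON THE IMAGE MEMBERS ONLY** (v1.1, the junction-ready form; dag-n05-w2 P5 NIT-1):
along any index ∕ period maps `ι, p`, from the [4]-Thm-3.3 socket `SockB9P3` at the members `ι j` ONLY — n05-a's `B8LeafModelZd3Map.prop3Printed_zd3_map`
(threshold chosen before the member) carried to periodic data by `prop3Printed_per_of_zd`.  On the (β′-PERIODIC) road N06's finite-torus objects feed the
socket at periodic members only, so this — not `prop3Printed_zdPer` — is the form the periodic pin consumes.
[cite: Balaban1985RegularSpaces, Prop. 3 p.87, (1.36)–(1.40) pp.82–83, (1.59) p.86, p.77 («Ω_j ⊂ T_η»); Balaban1985BackgroundPropagators, Thm 3.3 p.399] -/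
theorem prop3Printed_zdPer_map [Nontrivial 𝔸] (hd2 : 2 ≤ d) (hL : 2 ≤ L) (inp : B8.B9Inputs) {B₀β C₂ cP : ℝ} (hB₀β : 0 ≤ B₀β)
    (hC₂ : 2097152 * ((d : ℝ) + 1) ^ 2 ≤ C₂) (hcP : 0 < cP) (β : ℝ) (len : Site d → ℝ)
    {J : Type} (ι : J → ZdIdx d L) (p : J → ℕ)
    (SB9 : ∀ j : J, SockB9P3 (𝔸 := 𝔸) L inp.B₀ B₀β cP β len (ι j).η (ι j).k (ι j).Ω (ι j).Λs (ι j).Λb) :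
    B8.Prop3Printed d (L : ℝ) C₂ inp B₀β (fun j : J => (zdGF3Per 𝔸 L β len (ι j) (p j)).toGFData2) :=
  prop3Printed_per_of_zd ι p (B8LeafModelZd3Map.prop3Printed_zd3_map (𝔸 := 𝔸) hd2 hL inp hB₀β hC₂ hcP β len ι SB9)

end Prop3

end Literature.MathematicalPhysics.QuantumFieldTheory.Balaban1983to89.B8LeafModelZdPer
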